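import Summits.QuantumFields.YangMills.Theses.EquipartitionCriticality

/-!
# Sketch — crux stmt-QuantumFields-8762 `CriticalContinuumLimit`, idea `euclidean-crossing-saturation`
(crux-ideate round 1, ideator 1)

First checkable statements of the line "Euclidean crossing ⇒ plaquette saturation":

* `bentCumulant` — the object: the third cumulant κ₃(A at (−t,+u e₁), P at 0, A at (−t,−u e₁))
  under Wilson's torus measure (the ONE Euclidean function read in two lattice frames).
* `twoFrameSqueeze` — the real-analysis kernel (PROVED): a lower bound `c e^{-I u}` (transverse
  frame, one-particle saturation with vertex pinned by Feynman–Hellmann) against an upper bound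
  `A e^{-m_P κ u} + B e^{-ν u}` (longitudinal frame: spectral threshold of P̃Ω, plus the
  multi-particle remainder) forces `m_P κ ≤ I` as soon as `I < ν`.
* `crossingRate_le` — the two frame readings of `bentCumulant` along t = κ u give `m_P κ ≤ I(κ)`.
-/

namespace Summit.QuantumFields.YangMills.Cruxes.CriticalContinuumLimit.EuclideanCrossing

open MeasureTheory Filter Topology
open Literature.MathematicalPhysics.QuantumFieldTheory Literature.MathematicalPhysics.QuantumLattice

/-- The crux this sketch serves (by name). -/
example : Prop := Summit.QuantumFields.YangMills.Theses.EquipartitionCriticality.CriticalContinuumLimit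

noncomputable section

variable {G : Type} [Group G] [TopologicalSpace G] [IsTopologicalGroup G] [CompactSpace G]
  [MeasurableSpace G] [BorelSpace G] {N : ℕ}

/-- **The bent third cumulant.** κ₃ of the three observables
`A` translated to `(−t, +u, 0, 0)`, `P` at the origin, `A` translated to `(−t, −u, 0, 0)`
under `wilsonMeasure ρ β` on the torus of side `S` (periodic lift; translation to position `v`
is `configShift (−v)`, as in `latticeConnectedCorr`). Read with `e₀` as time the two `A`'s are
simultaneous at time `−t`; read with `e₁` as time they sit at times `±u` and `P` is displaced by
`t` in space. -/
def bentCumulant (ρ : G →* Matrix (Fin N) (Fin N) ℂ) (β : ℝ) (S : ℕ) [NeZero S]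
    (A P : LGConfig 4 G → ℝ) (t u : ℕ) : ℝ :=
  let μ := wilsonMeasure (d := 4) (L := S) ρ β
  let X : GaugeConfig 4 S G → ℝ := fun U =>
    A (configShift (-(-(Pi.single 0 (t : ℤ)) + Pi.single 1 (u : ℤ))) (torusLift S U))
  let Y : GaugeConfig 4 S G → ℝ := fun U =>
    A (configShift (-(-(Pi.single 0 (t : ℤ)) - Pi.single 1 (u : ℤ))) (torusLift S U))
  let Z : GaugeConfig 4 S G → ℝ := fun U => P (torusLift S U)
  (∫ U, X U * Z U * Y U ∂μ) - (∫ U, X U ∂μ) * (∫ U, Z U * Y U ∂μ)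
    - (∫ U, Z U ∂μ) * (∫ U, X U * Y U ∂μ) - (∫ U, Y U ∂μ) * (∫ U, X U * Z U ∂μ)
    + 2 * ((∫ U, X U ∂μ) * (∫ U, Z U ∂μ) * (∫ U, Y U ∂μ))

/-- Longitudinal (`e₀`-frame) reading, as a hypothesis shape: along `t = ⌊κ u⌋` the bent cumulant
of the curvature species is bounded by `K e^{-m_P κ u}` (spectral threshold `m_P` of `P̃Ω`;
`K = ‖Ψ_u‖ √Var P`, bounded in `u`). Tori `S u` grow with `u`. -/
def LongitudinalBound (ρ : G →* Matrix (Fin N) (Fin N) ℂ) (β : ℝ) (S : ℕ → ℕ)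
    (A P : LGConfig 4 G → ℝ) (κ K mP : ℝ) : Prop :=
  ∀ᶠ u : ℕ in atTop, ∀ [NeZero (S u)],
    |bentCumulant ρ β (S u) A P ⌊κ * u⌋₊ u| ≤ K * Real.exp (-(mP * κ * u))

/-- Transverse (`e₁`-frame) reading, as a hypothesis shape: one-particle saturation of the
lightest shell with the Feynman–Hellmann vertex gives `c e^{-I(κ) u} ≤ |κ₃|` along `t = ⌊κ u⌋`
(`c ∝ |∂_β m_*(β)| ≠ 0`). -/
def TransverseLower (ρ : G →* Matrix (Fin N) (Fin N) ℂ) (β : ℝ) (S : ℕ → ℕ)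
    (A P : LGConfig 4 G → ℝ) (κ c I : ℝ) : Prop :=
  ∀ᶠ u : ℕ in atTop, ∀ [NeZero (S u)],
    c * Real.exp (-(I * u)) ≤ |bentCumulant ρ β (S u) A P ⌊κ * u⌋₊ u|

end

/-- **Two-frame squeeze** (the real-analysis kernel of Euclidean crossing). If eventually
`c e^{-I u} ≤ A e^{-m_P κ u} + B e^{-ν u}` with `c > 0` and `I < ν`, then `m_P κ ≤ I`. -/
theorem twoFrameSqueeze (mP I κ c A B ν : ℝ) (hc : 0 < c) (hI : I < ν)
    (h : ∀ᶠ u : ℝ in atTop,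
      c * Real.exp (-(I * u)) ≤ A * Real.exp (-(mP * κ * u)) + B * Real.exp (-(ν * u))) :
    mP * κ ≤ I := by
  by_contra hlt
  push_neg at hlt
  set δ := min (mP * κ) ν - I with hδ
  have hδpos : 0 < δ := by rw [hδ]; exact sub_pos.mpr (lt_min hlt hI)
  have hle1 : I + δ ≤ mP * κ := by rw [hδ]; linarith [min_le_left (mP * κ) ν]
  have hle2 : I + δ ≤ ν := by rw [hδ]; linarith [min_le_right (mP * κ) ν]
  have h2 : ∀ᶠ u : ℝ in atTop, c ≤ (|A| + |B|) * Real.exp (-(δ * u)) := by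
    filter_upwards [h, eventually_ge_atTop (0 : ℝ)] with u hu hu0
    have e1 : A * Real.exp (-(mP * κ * u)) ≤ |A| * Real.exp (-((I + δ) * u)) := by
      calc A * Real.exp (-(mP * κ * u)) ≤ |A| * Real.exp (-(mP * κ * u)) :=
            mul_le_mul_of_nonneg_right (le_abs_self A) (Real.exp_pos _).le
        _ ≤ |A| * Real.exp (-((I + δ) * u)) := by
            apply mul_le_mul_of_nonneg_left _ (abs_nonneg A)
            apply Real.exp_le_exp.mpr
            exact neg_le_neg (mul_le_mul_of_nonneg_right hle1 hu0)
    have e2 : B * Real.exp (-(ν * u)) ≤ |B| * Real.exp (-((I + δ) * u)) := by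
      calc B * Real.exp (-(ν * u)) ≤ |B| * Real.exp (-(ν * u)) :=
            mul_le_mul_of_nonneg_right (le_abs_self B) (Real.exp_pos _).le
        _ ≤ |B| * Real.exp (-((I + δ) * u)) := by
            apply mul_le_mul_of_nonneg_left _ (abs_nonneg B)
            apply Real.exp_le_exp.mpr
            exact neg_le_neg (mul_le_mul_of_nonneg_right hle2 hu0)
    have hsplit : Real.exp (-((I + δ) * u)) = Real.exp (-(I * u)) * Real.exp (-(δ * u)) := by
      rw [← Real.exp_add]; congr 1; ring
    have hE : 0 < Real.exp (-(I * u)) := Real.exp_pos _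
    have h3 : c * Real.exp (-(I * u)) ≤
        ((|A| + |B|) * Real.exp (-(δ * u))) * Real.exp (-(I * u)) := by
      calc c * Real.exp (-(I * u)) ≤ A * Real.exp (-(mP * κ * u)) + B * Real.exp (-(ν * u)) := hu
        _ ≤ |A| * Real.exp (-((I + δ) * u)) + |B| * Real.exp (-((I + δ) * u)) := add_le_add e1 e2
        _ = ((|A| + |B|) * Real.exp (-(δ * u))) * Real.exp (-(I * u)) := by rw [hsplit]; ring
    exact le_of_mul_le_mul_right h3 hE
  have hmul : Tendsto (fun u : ℝ => δ * u) atTop atTop := tendsto_id.const_mul_atTop hδpos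
  have hexp : Tendsto (fun u : ℝ => Real.exp (-(δ * u))) atTop (𝓝 0) :=
    Real.tendsto_exp_neg_atTop_nhds_zero.comp hmul
  have h4 : Tendsto (fun u : ℝ => (|A| + |B|) * Real.exp (-(δ * u))) atTop (𝓝 0) := by
    simpa using hexp.const_mul (|A| + |B|)
  have h5 : ∀ᶠ u : ℝ in atTop, (|A| + |B|) * Real.exp (-(δ * u)) < c :=
    h4.eventually (gt_mem_nhds hc)
  obtain ⟨u, hu1, hu2⟩ := (h2.and h5).exists
  exact absurd (lt_of_le_of_lt hu1 hu2) (lt_irrefl c)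

/-- **Crossing rate bound** (abstract form of the line's output): if a real function `f` (the
bent cumulant along `t = κu`, cast to `ℝ → ℝ`) is eventually bounded above in modulus by
`K e^{-m_P κ u}` (longitudinal frame) and below by `c e^{-I u}`, `c > 0` (transverse frame), then
`m_P κ ≤ I`; with `I = I_A(κ) → 2 m_* √(1+κ²)`-type rates this is `m_P ≤ inf_κ I_A(κ)/κ`. -/
theorem crossingRate_le (f : ℝ → ℝ) (mP I κ c K : ℝ) (hc : 0 < c)
    (hlong : ∀ᶠ u : ℝ in atTop, |f u| ≤ K * Real.exp (-(mP * κ * u)))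
    (htrans : ∀ᶠ u : ℝ in atTop, c * Real.exp (-(I * u)) ≤ |f u|) :
    mP * κ ≤ I := by
  refine twoFrameSqueeze mP I κ c K 0 (I + 1) hc (by linarith) ?_
  filter_upwards [hlong, htrans] with u h1 h2
  have : c * Real.exp (-(I * u)) ≤ K * Real.exp (-(mP * κ * u)) := h2.trans h1
  simpa using this

end Summit.QuantumFields.YangMills.Cruxes.CriticalContinuumLimit.EuclideanCrossing
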